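import Mathlib

/-!
# Stub `stub_tangencySets` (crux `LevelOneGL2Designs`, stmt-MatrixMultiplication-14080) —
wall-breaker axis 1/12 "Hermitian unital constructions": descent to the prime subplane

The Hermitian-unital axis proves the stub's conclusion over every finite field of SQUARE order
(`…StubTangencySetsHermitian.lean`, `FlagLine.TangencyHermitian.hermitian_srs`: the `q³` affine
points of `H = {(a,b) : b + b^q = a^q a}`, `|F| = q²`, with their tangents `y = a^q x − b^q`).
The stub itself lives over the PRIME field `ZMod p`, i.e. inside the Baer subplane of the
`q`-Frobenius-fixed points `K = {x : x^q = x}` (`|K| = q`) when `F ⊇ ZMod p` has order `p²`.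
This file records, sorry-free, what survives the descent `F² ⊋ K²`:

* `hermitian_fixed_iff_conic` — on `K²` the Hermitian equation `b + b^q = a^q a` IS the conic
  `2b = a²`;
* `hermitian_covector_fixed` — at such a point the normalised Hermitian tangent covector
  `(a^q/b^q, −1/b^q)` IS the conic's tangent covector `(a/b, −1/b)` (the flags of
  `TangencyRandAlg.parabola_srs`, up to the factor `2`);
* `card_hermitian_fixed_le` — hence `H ∩ K²` has at most `|K| ≤ q = |F|^{1/2}` points
  (versus `|H| = q³ = |F|^{3/2}`): the unital's shadow in a plane of prime order is the conic,
  exponent `1`, which is why the axis cannot touch the prime-order statement (a plane of prime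
  order has no unital: `√p ∉ ℕ`; `ZMod p` has no ring automorphism of order `2`).

For the status of the prime-order statement see Hunter–Pohoata–Verstraëte–Zhang (2026),
arXiv:2601.19879: `p^{1.2334} ≪ IM(2,p) ≤ p^{3/2} + p`, and their Conjecture 10.2
(`IM(2,p) ≤ p^{3/2−c}` for all large primes) asserts that the stub is false.
Elementary; Mathlib only; no definitions.
-/

-- `MatrixMultiplication.MatrixMultiplication` is the tree's Summit/Problem path (D-0017); the
-- duplicated namespace component is intended, as in the sibling stub files of this crux.
set_option linter.dupNamespace false

noncomputable section

open Finset Polynomial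

namespace Summit.MatrixMultiplication.MatrixMultiplication.Theorems.LevelOneGL2Designs.HermitianUnital

section Descent

variable {F : Type*} [Field F]

/-- **On the Frobenius-fixed subplane the Hermitian curve is a conic.**  If `a^q = a` and
`b^q = b` then `b + b^q = a^q · a ↔ 2b = a·a`. [elementary] -/
theorem hermitian_fixed_iff_conic (q : ℕ) {a b : F} (ha : a ^ q = a) (hb : b ^ q = b) :
    b + b ^ q = a ^ q * a ↔ 2 * b = a * a := by
  rw [ha, hb, two_mul]

/-- **The Hermitian tangent at a subplane point is the conic tangent.**  If `a^q = a` and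
`b^q = b`, the normalised Hermitian tangent covector `(a^q/b^q, −1/b^q)` equals the conic
covector `(a/b, −1/b)` of `2y = x²` at `(a,b)`. [elementary] -/
theorem hermitian_covector_fixed (q : ℕ) {a b : F} (ha : a ^ q = a) (hb : b ^ q = b) :
    (![a ^ q * (b ^ q)⁻¹, -(b ^ q)⁻¹] : Fin 2 → F) = ![a * b⁻¹, -b⁻¹] := by
  rw [ha, hb]

variable [Fintype F] [DecidableEq F]

/-- The `q`-th power map fixes at most `q` elements (roots of `X^q − X`), `q ≥ 2`. [folklore] -/
theorem card_powFixed_le (q : ℕ) (hq : 1 < q) :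
    (univ.filter fun c : F => c ^ q = c).card ≤ q := by
  set P : F[X] := X ^ q - X with hPdef
  have hP : P ≠ 0 := FiniteField.X_pow_card_sub_X_ne_zero F hq
  have hdeg : P.natDegree = q := FiniteField.X_pow_card_sub_X_natDegree_eq F hq
  calc (univ.filter fun c : F => c ^ q = c).card ≤ P.roots.toFinset.card := by
        refine Finset.card_le_card fun c hc => ?_
        simp only [Finset.mem_filter, Finset.mem_univ, true_and] at hc
        rw [Multiset.mem_toFinset, Polynomial.mem_roots hP]
        simp [hPdef, hc]
    _ ≤ Multiset.card P.roots := Multiset.toFinset_card_le _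
    _ ≤ P.natDegree := Polynomial.card_roots' P
    _ = q := hdeg

/-- **Descent count.**  In any field, the points of the Hermitian curve `b + b^q = a^q a` with both
coordinates fixed by the `q`-th power map number at most `|{c : c^q = c}|`: in characteristic
`≠ 2` such a point is `(a, a²/2)`, determined by `a`; in characteristic `2` it is `(0, b)`,
determined by `b`.  With `card_powFixed_le` this is `≤ q = |F|^{1/2}` when `|F| = q²`, against
the `q³` points of the whole curve (`FlagLine.TangencyHermitian.card_hermitian`). [elementary] -/
theorem card_hermitian_fixed_le (q : ℕ) :
    (univ.filter fun ab : F × F =>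
        ab.2 + ab.2 ^ q = ab.1 ^ q * ab.1 ∧ ab.1 ^ q = ab.1 ∧ ab.2 ^ q = ab.2).card ≤
      (univ.filter fun c : F => c ^ q = c).card := by
  set HK := univ.filter fun ab : F × F =>
      ab.2 + ab.2 ^ q = ab.1 ^ q * ab.1 ∧ ab.1 ^ q = ab.1 ∧ ab.2 ^ q = ab.2 with hHK
  set K := univ.filter fun c : F => c ^ q = c with hK
  have hmem : ∀ ab ∈ HK, 2 * ab.2 = ab.1 * ab.1 ∧ ab.1 ∈ K ∧ ab.2 ∈ K := by
    intro ab hab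
    simp only [hHK, mem_filter, mem_univ, true_and] at hab
    obtain ⟨hH, ha, hb⟩ := hab
    refine ⟨(hermitian_fixed_iff_conic q ha hb).mp hH, ?_, ?_⟩
    · simpa [hK] using ha
    · simpa [hK] using hb
  by_cases h2 : (2 : F) = 0
  · -- characteristic 2: `a·a = 0`, so `a = 0` and the point is determined by `b ∈ K`
    calc HK.card ≤ (HK.image Prod.snd).card := by
          refine Finset.card_le_card_of_injOn Prod.snd (fun ab hab => mem_image_of_mem _ hab) ?_
          intro ab hab ab' hab' h
          obtain ⟨hc, -, -⟩ := hmem ab hab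
          obtain ⟨hc', -, -⟩ := hmem ab' hab'
          rw [h2, zero_mul] at hc hc'
          have ha : ab.1 = 0 := by simpa using hc.symm
          have ha' : ab'.1 = 0 := by simpa using hc'.symm
          exact Prod.ext (ha.trans ha'.symm) h
      _ ≤ K.card := by
          refine Finset.card_le_card fun b hb => ?_
          obtain ⟨ab, hab, rfl⟩ := Finset.mem_image.mp hb
          exact (hmem ab hab).2.2
  · -- characteristic ≠ 2: `b = a·a/2`, so the point is determined by `a ∈ K`
    calc HK.card ≤ (HK.image Prod.fst).card := by
          refine Finset.card_le_card_of_injOn Prod.fst (fun ab hab => mem_image_of_mem _ hab) ?_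
          intro ab hab ab' hab' h
          obtain ⟨hc, -, -⟩ := hmem ab hab
          obtain ⟨hc', -, -⟩ := hmem ab' hab'
          refine Prod.ext h ?_
          apply mul_left_cancel₀ h2
          rw [hc, hc', h]
      _ ≤ K.card := by
          refine Finset.card_le_card fun a ha => ?_
          obtain ⟨ab, hab, rfl⟩ := Finset.mem_image.mp ha
          exact (hmem ab hab).2.1

/-- **The unital's shadow in the subplane has at most `√|F|` points.**  If `|F| = q²` then the
Hermitian curve has at most `q` points with both coordinates in the Frobenius-fixed subfield
(the Baer subplane over which the stub is stated when `q = p`), compared with its `q³` points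
over `F`. [elementary; dead-axis calibration for `stub_tangencySets`] -/
theorem card_hermitian_fixed_le_sqrt (q : ℕ) (hF : Fintype.card F = q ^ 2) :
    (univ.filter fun ab : F × F =>
        ab.2 + ab.2 ^ q = ab.1 ^ q * ab.1 ∧ ab.1 ^ q = ab.1 ∧ ab.2 ^ q = ab.2).card ≤ q := by
  have hq : 1 < q := by
    have h1 : 1 < Fintype.card F := Fintype.one_lt_card
    rw [hF] at h1
    by_contra h
    have hq1 : q ≤ 1 := not_lt.mp h
    have : q ^ 2 ≤ 1 := by
      calc q ^ 2 ≤ 1 ^ 2 := Nat.pow_le_pow_left hq1 2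
        _ = 1 := one_pow 2
    omega
  exact (card_hermitian_fixed_le q).trans (card_powFixed_le q hq)

end Descent

end Summit.MatrixMultiplication.MatrixMultiplication.Theorems.LevelOneGL2Designs.HermitianUnital
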